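import Mathlib.AlgebraicGeometry.ZariskisMainTheorem
import Literature.AlgebraicGeometry.Motives.CyclesBirationalLiftProofs
import Literature.AlgebraicGeometry.Motives.CyclesAbelianVarietiesProofs
import Literature.AlgebraicGeometry.Motives.VarietiesGeometricallyIntegralProofs
import Literature.AlgebraicGeometry.Motives.VarietiesProperProofs
import HarnessLib

/-!
# Generic finiteness of a degree-`k` morphism of smooth projective `d`-folds

Family `hodge`, layer `Literature/AlgebraicGeometry/Motives`. For a morphism `q : T ⟶ W` of smooth
projective varieties of the same dimension `d` over `ℂ` with `q_*[T] = k • [W]` as cycles (`k ≥ 1`,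
i.e. `q` dominant, generically finite of degree `k = [K(T) : K(W)]`), the generic point `η_W` of `W`
has an open neighbourhood `U` over which `q` is FINITE:
`exists_isFinite_morphismRestrict_of_map_primeCycle_eq_nsmul`. This is the first step of
"a general fibre of a generically finite dominant morphism of degree `k` has `k` points"
(Harris, *Algebraic Geometry*, Prop. 7.16), in the form consumed by the reduction of Fulton's
degree formula for the complex orientations
(`HodgeTheory/ComplexOrientationDegreeFormulaReduction`, hypothesis `h4`).

Proof: from the cycle equation, `q η_T = η_W` (`base_eq_of_algebraicCycleMap_primeCycle_eq_nsmul`);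
the fibre of `q` over `η_W` is `{η_T}` — a point `t` over `η_W` has
`d = dim closure {η_W} ≤ dim closure {t}` because proper maps are closed and closed maps do not
raise dimension (`height_base_le_of_isClosedMap`), and the generic point is the only point of
dimension `d` of the `d`-fold `T` (`eq_genericPoint_of_height_eq_of_isSmoothProjective`); a proper
morphism with a finite fibre over `y` is finite over an open neighbourhood of `y` (Stacks Tag 02UP,
from Zariski's Main Theorem; Mathlib
`exists_isFinite_morphismRestrict_of_finite_preimage_singleton`). Everything here is proved.

## References

* [StacksProject] The Stacks Project, More on Morphisms, Lemma 37.44.2 (Tag 02UP); Chow Homology,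
  Lemma 42.16.2 (Tag 02RM).
* [Harris1992] J. Harris, Algebraic Geometry: A First Course, GTM 133, Springer 1992, Prop. 7.16.
* [Fulton1998] W. Fulton, Intersection Theory, 2nd ed., Springer 1998, §1.4.

#harness_tags algebraic_geometry.finite_morphisms, algebraic_geometry.projective_varieties
-/

noncomputable section

open CategoryTheory CategoryTheory.Limits AlgebraicGeometry Order

universe u

namespace Literature.AlgebraicGeometry.Motives

section GenericFiniteness

variable {K : Type u} [Field K] {d : ℕ} {T W : SchemeOver K}

/-- If `q_*[closure {η}] = k • [closure {z}]` with `k ≠ 0`, then `q η = z` (the push-forward of a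
prime cycle is supported on the image point, Fulton §1.4). [cite: Fulton1998, §1.4] -/
theorem base_eq_of_algebraicCycleMap_primeCycle_eq_nsmul (q : T ⟶ W) [QuasiCompact q.left]
    {η : T.left} {z : W.left} {k : ℕ} (hk : k ≠ 0)
    (h : AlgebraicCycle.map q.left height height (primeCycle η) = k • primeCycle z) :
    q.left.base η = z := by
  classical
  by_contra hne
  have h1 := congrArg (fun c : AlgebraicCycle W.left ℤ ↦ c z) h
  simp only [algebraicCycleMap_primeCycle_eq_nsmul, Function.locallyFinsuppWithin.coe_nsmul,
    Pi.smul_apply, primeCycle_apply_self, primeCycle_apply_of_ne (Ne.symm hne), smul_zero,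
    nsmul_eq_mul, mul_one] at h1
  exact hk (by exact_mod_cast h1.symm)

/-- On a smooth projective `d`-fold the generic point is the only point of dimension `≥ d`
(every point has dimension `≤ d`, and a strict specialisation of a point of finite dimension has
strictly smaller dimension). [cite: GortzWedhorn2020, Lemma 5.7 (4)] -/
theorem eq_genericPoint_of_le_height_of_isSmoothProjective (hT : IsSmoothProjective d T)
    [IsIntegral T.left] {t : T.left} (ht : (d : ℕ∞) ≤ height t) : t = genericPoint T.left := by
  have hgen : height (genericPoint T.left) = d := hT.height_genericPoint
  by_contra hne
  have hle : t ≤ genericPoint T.left :=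
    Scheme.le_iff_specializes.mpr (genericPoint_specializes t)
  have hlt : t < genericPoint T.left := lt_of_le_not_ge hle fun hge ↦
    hne ((Scheme.le_iff_specializes.mp hge).antisymm (genericPoint_specializes t)).eq
  have h := height_strictMono hlt (lt_of_le_of_lt (hT.height_le t) (ENat.coe_lt_top d))
  rw [hgen] at h
  exact lt_irrefl _ (lt_of_le_of_lt ht h)

/-- **The fibre over the generic point of a degree-`k` morphism of smooth projective `d`-folds is
the generic point**: for `q : T ⟶ W` between smooth projective `d`-folds with
`q_*[T] = k • [W]`, `k ≠ 0`, one has `q⁻¹(η_W) = {η_T}` — `q η_T = η_W`, and a point `t` over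
`η_W` has `d = dim closure {η_W} ≤ dim closure {t}` (proper maps are closed, and closed maps do not
raise dimension), forcing `t = η_T`. [cite: StacksProject, Tag 02RM] [cite: Fulton1998, §1.4] -/
theorem preimage_singleton_eq_of_map_primeCycle_eq_nsmul (hT : IsSmoothProjective d T)
    (hW : IsSmoothProjective d W) (q : T ⟶ W) [QuasiCompact q.left] {θ : T.left} {ω : W.left}
    (hθ : IsGenericPoint θ Set.univ) (hω : IsGenericPoint ω Set.univ) {k : ℕ} (hk : k ≠ 0)
    (h : AlgebraicCycle.map q.left height height (primeCycle θ) = k • primeCycle ω) :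
    q.left.base ⁻¹' {ω} = {θ} := by
  haveI : IsIntegral T.left := IsSmoothProjective.isIntegral_holds hT
  haveI : IsIntegral W.left := IsSmoothProjective.isIntegral_holds hW
  haveI : IsProper T.hom := IsSmoothProjective.isProper_holds hT
  haveI : IsProper W.hom := IsSmoothProjective.isProper_holds hW
  haveI : IsProper (q.left ≫ W.hom) := by
    rw [Over.w q]
    infer_instance
  haveI : IsProper q.left := IsProper.of_comp q.left W.hom
  have hθgen : θ = genericPoint T.left := hθ.eq (genericPoint_spec T.left)
  have hωgen : ω = genericPoint W.left := hω.eq (genericPoint_spec W.left)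
  have hωd : height ω = d := hωgen ▸ hW.height_genericPoint
  have hqθ : q.left.base θ = ω := base_eq_of_algebraicCycleMap_primeCycle_eq_nsmul q hk h
  ext t
  simp only [Set.mem_preimage, Set.mem_singleton_iff]
  refine ⟨fun ht ↦ ?_, fun ht ↦ ht ▸ hqθ⟩
  have hle : (d : ℕ∞) ≤ height t := by
    rw [← hωd, ← ht]
    exact height_base_le_of_isClosedMap q.left q.left.isClosedMap t
  rw [hθgen]
  exact eq_genericPoint_of_le_height_of_isSmoothProjective hT hle

/-- **Generic finiteness of a degree-`k` morphism of smooth projective `d`-folds** (over any field):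
for `q : T ⟶ W` between smooth projective `d`-folds with `q_*[T] = k • [W]` as cycles, `k ≥ 1`,
the generic point `η_W` has an open neighbourhood `U ⊆ W` with `q⁻¹(U) → U` finite — the fibre
over `η_W` is the single point `η_T` (`preimage_singleton_eq_of_map_primeCycle_eq_nsmul`), and a
proper morphism with finite fibre over `y` is finite over a neighbourhood of `y` (Zariski's Main
Theorem, Stacks Tag 02UP). [cite: StacksProject, Tag 02UP] [cite: Harris1992, Prop. 7.16] -/
theorem exists_isFinite_morphismRestrict_of_map_primeCycle_eq_nsmul' (hT : IsSmoothProjective d T)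
    (hW : IsSmoothProjective d W) (q : T ⟶ W) [QuasiCompact q.left] {θ : T.left} {ω : W.left}
    (hθ : IsGenericPoint θ Set.univ) (hω : IsGenericPoint ω Set.univ) {k : ℕ} (hk : k ≠ 0)
    (h : AlgebraicCycle.map q.left height height (primeCycle θ) = k • primeCycle ω) :
    ∃ U : W.left.Opens, ω ∈ U ∧ IsFinite (q.left ∣_ U) := by
  haveI : IsProper T.hom := IsSmoothProjective.isProper_holds hT
  haveI : IsProper W.hom := IsSmoothProjective.isProper_holds hW
  haveI : IsProper (q.left ≫ W.hom) := by
    rw [Over.w q]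
    infer_instance
  haveI : IsProper q.left := IsProper.of_comp q.left W.hom
  refine exists_isFinite_morphismRestrict_of_finite_preimage_singleton q.left ω ?_
  rw [show ⇑q.left ⁻¹' {ω} = {θ} from
    preimage_singleton_eq_of_map_primeCycle_eq_nsmul hT hW q hθ hω hk h]
  exact Set.finite_singleton θ

end GenericFiniteness

/-- **Generic finiteness of a degree-`k` morphism of smooth projective complex `d`-folds**, in the
form consumed by the reduction of Fulton's degree formula for the complex orientations: for
`q : T ⟶ W` between smooth projective `d`-folds over `ℂ` with generic points `θ`, `ω` and
`q_*[closure {θ}] = k • [closure {ω}]`, `0 < k`, there is an open `U ∋ ω` of `W` with `q ∣_ U`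
finite. [cite: StacksProject, Tag 02UP] [cite: Harris1992, Prop. 7.16] -/
theorem exists_isFinite_morphismRestrict_of_map_primeCycle_eq_nsmul :
    ∀ ⦃d : ℕ⦄ ⦃T W : Motives.SchemeOver ℂ⦄ (hT : Motives.IsSmoothProjective d T)
      (hW : Motives.IsSmoothProjective d W) (q : T ⟶ W) [QuasiCompact q.left] ⦃θ : T.left⦄
      ⦃ω : W.left⦄, IsGenericPoint θ Set.univ → IsGenericPoint ω Set.univ → ∀ ⦃k : ℕ⦄, 0 < k →
      AlgebraicCycle.map q.left Order.height Order.height (Motives.primeCycle θ) =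
        k • Motives.primeCycle ω →
      ∃ U : W.left.Opens, ω ∈ U ∧ IsFinite (q.left ∣_ U) :=
  fun _ _ _ hT hW q _ _ _ hθ hω _ hk h ↦
    exists_isFinite_morphismRestrict_of_map_primeCycle_eq_nsmul' hT hW q hθ hω
      (Nat.pos_iff_ne_zero.mp hk) h

end Literature.AlgebraicGeometry.Motives

end
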